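import Summits.BirchSwinnertonDyer.Rank1Residual.ManinAdditive.ThetaBrandtTamagawaTwoOptimal
import Literature.NumberTheory.EllipticCurves.NeronComponentIndexTypeIVProofs
import Literature.NumberTheory.EllipticCurves.NeronComponentIndexTypeIVstarProofs
import Literature.NumberTheory.EllipticCurves.TamagawaRingEquivProofs
import Literature.NumberTheory.EllipticCurves.LocalTorsionAdditiveTamagawaProofs
import Literature.NumberTheory.EllipticCurves.BSDConductorProofs
import Literature.NumberTheory.DiophantineGeometry.ConductorAdditiveProofs
import Literature.NumberTheory.DiophantineGeometry.ConductorRingOfIntegersProofs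
import Literature.NumberTheory.DiophantineGeometry.ConductorFactorizationProofs
import HarnessLib

/-!
# The two folklore Tate facts at `4 ∥ N` of the θ-Brandt line, DISCHARGED:
# `4 ∥ N ⟹ c₂ ∈ {1, 3}` and `4 ∥ N ∧ E(ℚ)[3] ≠ 0 ⟹ c₂ = 3`
# (route `ManinLocalTwoThree`, cell bsd-f2-manin; desc lane rows E-desc-119R / 119♭R / 122 of
# `ThetaBrandtTamagawaTwoOptimal.lean`; prover seat p3 gen 13)

THE POINT.  desc g18 / typer g18 typed the two E-side inputs of the pointwise θ-Brandt edge as NAMED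
folklore facts (ref1 THEOREM T1, Tate's algorithm), nothing asserted:

* `ThetaBrandt.TamagawaTwoMemOneThreeAtFour` — `4 ∥ N_E ⟹ c₂(E) ∈ {1, 3}`;
* `ThetaBrandt.TamagawaTwoOfThreeTorsionAtFour` — `4 ∥ N_E` and `E(ℚ)[3] ≠ 0 ⟹ c₂(E) = 3`.

This file PROVES both (`tamagawaTwoMemOneThreeAtFour_holds`, `tamagawaTwoOfThreeTorsionAtFour_holds`)
from the tree's Tate-algorithm library, so that desc's proved edges
`ThetaBrandt.tamagawaTwoFromBrandtOptimal_of_signLawOptimal` (E-desc-119R ∧ E-desc-118 ⟹ E-desc-119♭R)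
and `ThetaBrandt.iotaSignOfThreeTorsion_of_signLawOptimal` (E-desc-119R ⟹ E-desc-122) lose their two
E-side fact hypotheses (`…_of_signLawOptimal'` below).

PROOF.  (1) `4 ∥ N` reads `f₂ = 2` at the place `v₂` of `𝓞 ℚ` over `2`
(`factorization_conductorNorm`, `conductorExponent_eq_of_primesEquiv_eq`); `f₂ = 2` over `ℚ₂` forces
Kodaira type `IV` or `IV*` (`kodairaSymbolAt_of_conductorExponent_eq_two_two'`, Papadopoulos's table for
`p = 2` from Tate's algorithm, tree `TameAdditiveTypesAtTwoProofs`); Tate's Steps 5 and 8 give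
`c_v ∈ {1, 3}` (`localTamagawaNumber_of_kodairaSymbolAt_eq_IV_holds` / `…_IVstar_holds`,
`NeronComponentIndexTypeIV(star)Proofs`); and `c_v` at `v₂` is desc's `tamagawaAt W 2`, computed in
Mathlib's `ℚ_[2]` (`localTamagawaNumber_padic_eq_holds`).  (2) `f₂ = 2 ≥ 2` means additive reduction at
`v₂` (`two_le_conductorExponent_iff_holds`); at an additive place `v ∤ 3` with `3 ∤ c_v` the group
`E(ℚ_v)` has no `3`-torsion (`forall_eq_zero_of_prime_pow_smul_eq_zero_of_hasAdditiveReductionAt_of_not_dvd`: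
`#E(K_v)[3] ∣ c_v · #Ẽ_ns(k_v)` with `#Ẽ_ns(𝔽₂) = 2`), so a rational point of order `3`, mapped
injectively into `E(ℚ_v)` (`Affine.Point.map_injective`), forces `3 ∣ c_v ∈ {1, 3}`, i.e. `c₂ = 3`.

HONEST FRAMING.  Two folklore local facts (Silverman *ATAEC* IV.9.4 Steps 5, 8 and Table 4.1; Tate 1975
§6) proved from the tree's formalised Tate algorithm; the desc-lane LAWS E-desc-119R / 119♭R / 122 stay
conjectures.  C2 `ManinOddAtFour`, Manin's conjecture and BSD are NOT proved by anything here.  No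
definitions, no sorry, axioms standard.

[cite: SilvermanATAEC1994, IV.9.4 Steps 5 and 8, Table 4.1 p. 365 (types IV, IV*: c ∈ {1, 3}; f = 2)]
[cite: Tate1975, §6 (the special fibre; c for types IV, IV*)]
[cite: SilvermanAEC2009, Prop. VII.2.1 and VII.3.1 (E(K_v)/E₀ and E₀/E₁ ≅ Ẽ_ns(k); torsion at an additive place)]
-/

set_option autoImplicit false
-- lint-debt: the directory name repeats the summit name (sibling precedent `ManinLocalTwoThreeGammaOneKatoRoad.lean`)
set_option linter.dupNamespace false

noncomputable section

open scoped Classical NumberField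
open IsDedekindDomain IsDedekindDomain.HeightOneSpectrum Rat.HeightOneSpectrum
open WeierstrassCurve Literature.NumberTheory.DiophantineGeometry Literature.NumberTheory.EllipticCurves
open Summit.BirchSwinnertonDyer.Rank1Residual.ManinAdditive
open Summit.BirchSwinnertonDyer.Rank1Residual.ManinAdditive.RamanujanCut (HasRationalThreeTorsion)
open Summit.BirchSwinnertonDyer.Rank1Residual.ManinAdditive.ThetaBrandt

namespace Summit.BirchSwinnertonDyer.BirchSwinnertonDyer.Theorems.ManinLocalTwoThree

/-! ## §1 The place `v₂` of `𝓞 ℚ` and the currency bridges -/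

/-- `primesEquiv v₂ = 2`. -/
private theorem primesEquiv_vTwo :
    ((primesEquiv (R := 𝓞 ℚ)) ((primesEquiv (R := 𝓞 ℚ)).symm ⟨2, Nat.prime_two⟩) : ℕ) = 2 := by
  rw [Equiv.apply_symm_apply]

/-- `2 ∈ v₂`. -/
private theorem two_mem_vTwo : (2 : 𝓞 ℚ) ∈ ((primesEquiv (R := 𝓞 ℚ)).symm ⟨2, Nat.prime_two⟩).asIdeal := by
  have h := (natCast_mem_asIdeal_iff_eq_primesEquiv_symm
    ((primesEquiv (R := 𝓞 ℚ)).symm ⟨2, Nat.prime_two⟩) Nat.prime_two).mpr rfl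
  simpa using h

/-- `3 ∉ v₂`. -/
private theorem three_not_mem_vTwo :
    ((3 : ℕ) : 𝓞 ℚ) ∉ ((primesEquiv (R := 𝓞 ℚ)).symm ⟨2, Nat.prime_two⟩).asIdeal := by
  intro h
  have h' := (natCast_mem_asIdeal_iff_eq_primesEquiv_symm
    ((primesEquiv (R := 𝓞 ℚ)).symm ⟨2, Nat.prime_two⟩) Nat.prime_three).mp h
  have h'' := congrArg (fun v => ((primesEquiv (R := 𝓞 ℚ)) v : ℕ)) h'
  simp only [Equiv.apply_symm_apply] at h''
  omega

/-- **`4 ∥ N_E ⟹ f_{v₂} = 2`** (`N_E = ∏ p ^ f_p`, Silverman *AEC* C.16; the exponent at the place of `𝓞 ℚ` over `2` is the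
one at the place of `ℤ` over `2`, `conductorExponent_eq_of_primesEquiv_eq`).
[cite: SilvermanAEC2009, C.16 (definition of the conductor)] -/
theorem conductorExponent_vTwo_eq_two_of_padicValNat_conductorNorm (W : WeierstrassCurve ℚ) [W.IsElliptic]
    (h2 : padicValNat 2 (W.conductorNorm ℤ) = 2) :
    W.conductorExponent ((primesEquiv (R := 𝓞 ℚ)).symm ⟨2, Nat.prime_two⟩) = 2 := by
  have h1 := factorization_conductorNorm_holds W ((primesEquiv (R := ℤ)).symm ⟨2, Nat.prime_two⟩)
  rw [show natGenerator ((primesEquiv (R := ℤ)).symm ⟨2, Nat.prime_two⟩) = 2 from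
    congrArg Subtype.val ((primesEquiv (R := ℤ)).apply_symm_apply ⟨2, Nat.prime_two⟩),
    Nat.factorization_def _ Nat.prime_two, h2] at h1
  rw [← WeierstrassCurve.conductorExponent_eq_of_primesEquiv_eq
    ((primesEquiv (R := ℤ)).symm ⟨2, Nat.prime_two⟩) ((primesEquiv (R := 𝓞 ℚ)).symm ⟨2, Nat.prime_two⟩) W
    (by simp)]
  exact h1.symm

/-- desc's `tamagawaAt W 2` is the local Tamagawa number at the place `v₂` of `𝓞 ℚ` (the factor of the tree's Tamagawa
product), by the `ℚ_[2]`-versus-`ℚ_{v₂}` transport `localTamagawaNumber_padic_eq_holds`. [folklore] -/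
theorem tamagawaAt_two_eq_localTamagawaNumber (W : WeierstrassCurve ℚ) [W.IsElliptic] :
    tamagawaAt W 2 =
      (W.baseChange ((((primesEquiv (R := 𝓞 ℚ)).symm ⟨2, Nat.prime_two⟩)).adicCompletion ℚ)).localTamagawaNumber
        (((primesEquiv (R := 𝓞 ℚ)).symm ⟨2, Nat.prime_two⟩).adicCompletionIntegers ℚ) := by
  unfold tamagawaAt
  rw [dif_pos Nat.prime_two]
  haveI : Fact (Nat.Prime 2) := ⟨Nat.prime_two⟩
  exact WeierstrassCurve.localTamagawaNumber_padic_eq_holds W _ 2 primesEquiv_vTwo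

/-! ## §2 `4 ∥ N ⟹ c₂ ∈ {1, 3}` -/

/-- **Local form: `f_{v₂} = 2 ⟹ c_{v₂} ∈ {1, 3}`** — Kodaira type `IV` or `IV*` at `2` (Papadopoulos's table for `p = 2`,
`kodairaSymbolAt_of_conductorExponent_eq_two_two'`) and Tate's Steps 5 / 8 (`localTamagawaNumber_of_kodairaSymbolAt_eq_IV_holds`,
`…_IVstar_holds`). [cite: SilvermanATAEC1994, IV.9.4 Steps 5 and 8, Table 4.1] -/
theorem localTamagawaNumber_vTwo_mem_of_conductorExponent_eq_two (W : WeierstrassCurve ℚ) [W.IsElliptic]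
    (hf : W.conductorExponent ((primesEquiv (R := 𝓞 ℚ)).symm ⟨2, Nat.prime_two⟩) = 2) :
    (W.baseChange ((((primesEquiv (R := 𝓞 ℚ)).symm ⟨2, Nat.prime_two⟩)).adicCompletion ℚ)).localTamagawaNumber
        (((primesEquiv (R := 𝓞 ℚ)).symm ⟨2, Nat.prime_two⟩).adicCompletionIntegers ℚ) = 1 ∨
      (W.baseChange ((((primesEquiv (R := 𝓞 ℚ)).symm ⟨2, Nat.prime_two⟩)).adicCompletion ℚ)).localTamagawaNumber
        (((primesEquiv (R := 𝓞 ℚ)).symm ⟨2, Nat.prime_two⟩).adicCompletionIntegers ℚ) = 3 := by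
  haveI : PerfectField (IsLocalRing.ResidueField (((primesEquiv (R := 𝓞 ℚ)).symm ⟨2, Nat.prime_two⟩).adicCompletionIntegers ℚ)) :=
    PerfectField.ofFinite
  rcases W.kodairaSymbolAt_of_conductorExponent_eq_two_two' two_mem_vTwo hf with ⟨hIV, -⟩ | ⟨hIVs, -⟩
  · exact localTamagawaNumber_of_kodairaSymbolAt_eq_IV_holds _ W hIV
  · exact localTamagawaNumber_of_kodairaSymbolAt_eq_IVstar_holds _ W hIVs

/-- **DISCHARGE of `ThetaBrandt.TamagawaTwoMemOneThreeAtFour`: `4 ∥ N_E ⟹ c₂(E) ∈ {1, 3}`** (ref1 THEOREM T1(ii); Tate's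
algorithm: `f₂ = 2` forces Kodaira `IV`/`IV*` at `2`, whose component groups have order `1` or `3`).
[cite: SilvermanATAEC1994, IV.9.4 Steps 5 and 8, Table 4.1 p. 365] [cite: Tate1975, §6] -/
theorem tamagawaTwoMemOneThreeAtFour_holds : TamagawaTwoMemOneThreeAtFour := by
  intro W _ h2
  rw [tamagawaAt_two_eq_localTamagawaNumber]
  exact localTamagawaNumber_vTwo_mem_of_conductorExponent_eq_two W
    (conductorExponent_vTwo_eq_two_of_padicValNat_conductorNorm W h2)

/-! ## §3 `4 ∥ N ∧ E(ℚ)[3] ≠ 0 ⟹ c₂ = 3` -/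

/-- **Local form: a rational point of order `3` at an additive place over `2` forces `3 ∣ c_{v₂}`.**  At an additive place
`v ∤ 3` with `3 ∤ c_v`, `E(ℚ_v)` has no `3`-torsion (`#E(ℚ_v)[3] ∣ c_v · #Ẽ_ns(𝔽₂) = 2 c_v`; tree
`forall_eq_zero_of_prime_pow_smul_eq_zero_of_hasAdditiveReductionAt_of_not_dvd`), and `E(ℚ) ↪ E(ℚ_v)`.
[cite: SilvermanAEC2009, Prop. VII.2.1 and VII.3.1] [cite: SilvermanATAEC1994, Cor. IV.9.2(d)] -/
theorem three_dvd_localTamagawaNumber_vTwo_of_hasRationalThreeTorsion (W : WeierstrassCurve ℚ) [W.IsElliptic]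
    (hadd : W.HasAdditiveReductionAt ((primesEquiv (R := 𝓞 ℚ)).symm ⟨2, Nat.prime_two⟩))
    (hT : HasRationalThreeTorsion W) :
    3 ∣ (W.baseChange ((((primesEquiv (R := 𝓞 ℚ)).symm ⟨2, Nat.prime_two⟩)).adicCompletion ℚ)).localTamagawaNumber
        (((primesEquiv (R := 𝓞 ℚ)).symm ⟨2, Nat.prime_two⟩).adicCompletionIntegers ℚ) := by
  by_contra h3
  obtain ⟨P, hP0, h3P⟩ := hT
  haveI : Fact (Nat.Prime 3) := ⟨Nat.prime_three⟩
  have hordP : addOrderOf P = 3 := addOrderOf_eq_prime h3P hP0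
  set Pv : (W.baseChange (((primesEquiv (R := 𝓞 ℚ)).symm ⟨2, Nat.prime_two⟩).adicCompletion ℚ)).toAffine.Point :=
    Affine.Point.map (W' := W.toAffine) (S := ℚ)
      (Algebra.ofId ℚ (((primesEquiv (R := 𝓞 ℚ)).symm ⟨2, Nat.prime_two⟩).adicCompletion ℚ)) P with hPv
  have hordPv : addOrderOf Pv = 3 :=
    (addOrderOf_injective _
      (Affine.Point.map_injective (W' := W.toAffine)
        (f := Algebra.ofId ℚ (((primesEquiv (R := 𝓞 ℚ)).symm ⟨2, Nat.prime_two⟩).adicCompletion ℚ))) P).trans hordP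
  have hPv3 : (3 ^ 1) • Pv = 0 := by
    rw [pow_one]; exact addOrderOf_dvd_iff_nsmul_eq_zero.mp (by rw [hordPv])
  have hzero := W.forall_eq_zero_of_prime_pow_smul_eq_zero_of_hasAdditiveReductionAt_of_not_dvd
    ((primesEquiv (R := 𝓞 ℚ)).symm ⟨2, Nat.prime_two⟩) hadd Nat.prime_three three_not_mem_vTwo h3 1 Pv hPv3
  rw [hzero, addOrderOf_zero] at hordPv
  exact absurd hordPv (by norm_num)

/-- **DISCHARGE of `ThetaBrandt.TamagawaTwoOfThreeTorsionAtFour`: `4 ∥ N_E ∧ E(ℚ)[3] ≠ 0 ⟹ c₂(E) = 3`** (ref1 THEOREM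
T1(γ): `E⁰(ℚ₂)` is uniquely `3`-divisible, so a rational `3`-torsion point is visible in `Φ₂(𝔽₂)`, of order `∈ {1, 3}`).
[cite: SilvermanATAEC1994, IV.9.4 Steps 5 and 8, Table 4.1; Cor. IV.9.2(d)] [cite: Tate1975, §6] -/
theorem tamagawaTwoOfThreeTorsionAtFour_holds : TamagawaTwoOfThreeTorsionAtFour := by
  intro W _ h2 hT
  have hf := conductorExponent_vTwo_eq_two_of_padicValNat_conductorNorm W h2
  haveI : PerfectField (IsLocalRing.ResidueField (((primesEquiv (R := 𝓞 ℚ)).symm ⟨2, Nat.prime_two⟩).adicCompletionIntegers ℚ)) :=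
    PerfectField.ofFinite
  have hadd : W.HasAdditiveReductionAt ((primesEquiv (R := 𝓞 ℚ)).symm ⟨2, Nat.prime_two⟩) :=
    (W.two_le_conductorExponent_iff_holds ((primesEquiv (R := 𝓞 ℚ)).symm ⟨2, Nat.prime_two⟩)).mp (by rw [hf])
  have h3 := three_dvd_localTamagawaNumber_vTwo_of_hasRationalThreeTorsion W hadd hT
  rw [tamagawaAt_two_eq_localTamagawaNumber]
  rcases localTamagawaNumber_vTwo_mem_of_conductorExponent_eq_two W hf with h1 | h3'
  · rw [h1] at h3; exact absurd h3 (by norm_num)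
  · exact h3'

/-! ## §4 desc's edges with the two facts discharged -/

/-- **E-desc-119R ∧ E-desc-118 ⟹ E-desc-119♭R**, the two folklore facts now PROVED (desc's
`tamagawaTwoFromBrandtOptimal_of_signLawOptimal` with `tamagawaTwoMemOneThreeAtFour_holds`, `tamagawaTwoOfThreeTorsionAtFour_holds`). -/
theorem tamagawaTwoFromBrandtOptimal_of_signLawOptimal'
    (h119 : ThetaIotaSignLawAtFourPrimeOptimal) (h118 : ThetaEisensteinCriterionAtFourPrime) :
    TamagawaTwoFromBrandtAtFourPrimeOptimal :=
  tamagawaTwoFromBrandtOptimal_of_signLawOptimal h119 h118 tamagawaTwoMemOneThreeAtFour_holds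
    tamagawaTwoOfThreeTorsionAtFour_holds

/-- **E-desc-119R ⟹ E-desc-122**, the folklore fact now PROVED (desc's `iotaSignOfThreeTorsion_of_signLawOptimal` with
`tamagawaTwoOfThreeTorsionAtFour_holds`). -/
theorem iotaSignOfThreeTorsion_of_signLawOptimal' (h119 : ThetaIotaSignLawAtFourPrimeOptimal) :
    ThetaIotaSignOfThreeTorsionAtFourPrimeOptimal :=
  iotaSignOfThreeTorsion_of_signLawOptimal h119 tamagawaTwoOfThreeTorsionAtFour_holds

end Summit.BirchSwinnertonDyer.BirchSwinnertonDyer.Theorems.ManinLocalTwoThree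

end
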